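import Literature.MathematicalPhysics.QuantumFieldTheory.Balaban1983to89.BalabanAdmissibleClassParams
import Literature.MathematicalPhysics.QuantumFieldTheory.Balaban1983to89.T4GenFunBounds
import Literature.MathematicalPhysics.QuantumFieldTheory.Balaban1983to89.MissingProofs
import Literature.MathematicalPhysics.QuantumFieldTheory.Balaban1983to89.B8Eq110UnitaryProof
import Literature.MathematicalPhysics.QuantumFieldTheory.Balaban1983to89.B14Eq16FaddeevPopov
import Literature.MathematicalPhysics.QuantumFieldTheory.Balaban1983to89.B16Thm1BaseAtRecord11
import Literature.MathematicalPhysics.QuantumFieldTheory.Balaban1983to89.T3Thresholds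
import Literature.MathematicalPhysics.QuantumFieldTheory.Balaban1983to89.T3BareTailProfile
import HarnessLib

/-!
# Route `BackwardLiouvilleRigidity` — NON-VACUITY OF THE ∃κ-MEMBERSHIP FRAME (`admFR_frame_inhabited`)

Tribunal J (verdict r8, 2026-08-30) and director-ym R606 ORDER (2) asked for a LANDED non-vacuity lemma for the per-height hypothesis frame
of the deciding crux `BackwardStabilityAdmFR` (stmt-QuantumFields-28294) after the R-n4 repair (idea-crit-5 #534 Q1: with κ = 0 the
NORMALISED membership of a PROBABILITY density concentrated on the window `{PlaqSmall (θBal … j)}` is uninhabited from a height on; the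
repair asks `MemAtHeight … (fun U => Real.exp κ * ρ j U)` for some real `κ`).  J's question: «is the frame inhabited by the Wilson runs
themselves — name the witness density and its normalisation».  ANSWER BY KERNEL, at EVERY height `j`, with the Wilson run `K = j` READ AT ITS
OWN FINEST LEVEL (zero averaging steps = Bałaban's starting density `ρ₀ = exp[−g₀⁻²A(U) + E]`, [Balaban1985UV3] (1) p.256):
* measure = THE WILSON LAW OF RUN `j`, `μ_j := gibbsK F ℰp γ j = T4GenFunBounds.gibbsMeasure (F.P j) ((F.scheme ℰp γ).β j)` (`β_j = L^j∕γ`);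
* density = its Haar density `ρ_j := boltzmann ∕ partitionFn` (a probability density, continuous, positive everywhere);
* NORMALISATION `κ_j := Real.log (partitionFn (F.P j) β_j)`, so that `exp κ_j · ρ_j = exp(−β_j·A)` = `boltzmann`;
* class witness (`BalabanUVClass.Witness`) on run `K = j` at level `k = j − j`: background = the datum (`Averaging.iter _ 0 = id`, trivial
  history), NO localisation domains, `cst = 0`, `lf = 0`, the two-sided representation (41)∕(47) WITH EQUALITY, the large-field clause
  (67)–(71) from `|g − 1|² ≤ 2N(1 − Re tr g)` (tree `B8Eq110UnitaryProof.cmp'_specialUnitaryGroup`): a `δL_j = 2θ_j`-large plaquette costs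
  `β_jθ_j² = p(g_j)² ≥ ¼p(g_j)² = cLF_j`;
* schedule = the tree's PRINTED one, `printedSchedule F γ b₀ p₀ κ₀ M₀ C₀ R₀` (`0 ≤ C₀`, `0 < κ₀`, `R₀ ≥ 2·sup_j θBal_j`), admissible.

Statements: `mem_boltzmann` (generic level 0), `memAtHeight_boltzmann` (height `j`, SU(2), `ℰp`), `admFR_frame_inhabited` (∃ admissible
schedule; at every height the named probability witness with its κ), `admFR_frame_inhabited_block` (the per-height hypothesis block of
`BackwardStabilityAdmFR` VERBATIM at `(μ, μ', ρ, ρ') := (μ_j, μ_j, ρ_j, ρ_j)`, any `ω_j ≥ 0`, any `η_j ≥ 1`, with `IsProbabilityMeasure`),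
`admFR_frame_inhabited_block_bareTail` (the same with the tree's summable bare tail profile `η` of the runs, `1 ≤ p₀`).

HONEST SCOPE.  Zero renormalisation steps: membership of the height-`j` densities of the runs `K > j` (after `K − j ≥ 1` block averagings,
[Balaban1985UV3] Thm 2 + Sect. D) and a CONSISTENT tower `μ_j = (descend F ℰp j)_* μ_{j+1}` of members are NOT touched — they are the
declared content of the crux `ClassLimitTrajectoriesAdmFR` (stmt-QuantumFields-28295).  Nothing of 28294∕28295∕28296 is proved; rung R3
(`YM3TorusSU2`, finite-volume SU(2) YM₃ on T³) and every summit statement stay OPEN; the Yang–Mills mass gap is NOT proved.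
-/

namespace Summit.QuantumFields.YangMills.Theorems.AdmFRFrameInhabited

open Filter Topology MeasureTheory
open Literature.MathematicalPhysics.QuantumFieldTheory.Balaban1983to89 T3ContinuumYM3Torus T3LevelShift T3NestedUnitLaws
  T3UnitLawDensityEML T3UnitScaleTilt BalabanUVClass Missing

/-! ## §1 Level 0 of any run: the Boltzmann weight is a class member for sign-coherent parameters -/

section LevelZero

variable {P : Params} {G : Type*} [GaugeGroup G] [MeasurableSpace G] [RegularGaugeGroup G]

/-- **THE WILSON BOLTZMANN WEIGHT `exp(−β·A)` IS IN BAŁABAN'S CLASS AT LEVEL 0** (zero averaging steps) for every averaging family and every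
parameter set with coherent signs (`δ ≤ δreg`, `0 ≤ β`, `0 ≤ δL`, `0 ≤ slack`, `0 ≤ Ccov`, `0 ≤ cE`, `0 ≤ c5`) whose large-field exponent is
paid by the action of one large plaquette (`cLF·C ≤ β·δL²` for a group inequality `|g − 1|² ≤ C(1 − Re tr g)`): the witness is the trivial
history of [Balaban1985UV3] (41)∕(47) p.266–267 — background = the datum, no localisation domains, `E = 0`, no large-field histories — and the
large-field small factors (67)–(71) p.273 come from the Wilson action itself. [cite: Balaban1985UV3, (1) p.256, (41)-(47) pp.266-267, (67)-(71) p.273] -/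
theorem mem_boltzmann (av : (i : ℕ) → Averaging P i G) (prm : ClassParams) {C : ℝ} (hC : 0 < C)
    (hcmp : ∀ g : G, dist1 g ^ 2 ≤ C * (1 - reTr g))
    (hδ : prm.δ ≤ prm.δreg) (hβ : 0 ≤ prm.β) (hδL : 0 ≤ prm.δL) (hLF : prm.cLF * C ≤ prm.β * prm.δL ^ 2)
    (hslack : 0 ≤ prm.slack) (hCcov : 0 ≤ prm.Ccov) (hcE : 0 ≤ prm.cE) (hc5 : 0 ≤ prm.c5) :
    Mem av prm (boltzmann P prm.β) := by
  classical
  refine ⟨{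
    bg := id
    nDom := 0
    supp := fun X => X.elim0
    foot := fun X => X.elim0
    len := fun X => X.elim0
    wt := fun X => X.elim0
    act := fun X => X.elim0
    cst := 0
    lf := fun _ => 0
    nonneg := fun V => (boltzmann_pos P prm.β V).le
    measurable := measurable_boltzmann RegularGaugeGroup.measurable_reTr P prm.β
    gaugeInvariant := ?_
    isBackground := ?_
    foot_nonempty := fun X => X.elim0
    supp_foot := fun X => X.elim0
    len_nonneg := fun X => X.elim0
    wt_nonneg := fun X => X.elim0
    diam_foot := fun X => X.elim0
    act_local := fun X => X.elim0
    act_gaugeInvariant := fun X => X.elim0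
    act_bound := fun X => X.elim0
    cover := ?_
    cst_abs_le := ?_
    lower := ?_
    upper := ?_
    lf_nonneg := fun _ => le_rfl
    lf_le := fun _ => by positivity
    large := ?_ }⟩
  · -- gauge invariance of `exp(−βA)`
    intro u U
    simp only [boltzmann, B14Eq16FaddeevPopov.wilsonAction4_gaugeAct']
  · -- the trivial history: at level 0 the background of a small datum is the datum
    intro V hV
    refine ⟨rfl, fun p => (hV p).trans_le hδ, fun U _ hU => ?_⟩
    exact (congrArg wilsonAction4 (show U = V from hU)).ge
  · -- no localisation domains: the per-site activity budget is `0 ≤ Ccov`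
    intro y
    simp [hCcov]
  · -- `cst = 0`
    simpa using mul_nonneg hcE (Nat.cast_nonneg _)
  · -- lower bound (47) with equality up to the slack
    intro V _
    simp only [boltzmann, id, Finset.univ_eq_empty, Finset.sum_empty, add_zero]
    exact Real.exp_le_exp.mpr (by linarith)
  · -- upper bound (41) with equality up to the slack, no large-field histories
    intro V _
    simp only [boltzmann, id, Finset.univ_eq_empty, Finset.sum_empty, add_zero]
    exact Real.exp_le_exp.mpr (by linarith)
  · -- large-field small factors from the Wilson action of the large plaquettes
    intro V S hS
    have h1 : (1 : ℝ) ≤ Real.exp (prm.c5 * Fintype.card (Site P 0)) := Real.one_le_exp (mul_nonneg hc5 (Nat.cast_nonneg _))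
    have hterm : ∀ p : Plaq P 0, 0 ≤ 1 - reTr (GaugeField.plaqHol V p) := fun p => by
      have := GaugeGroup.reTr_le_one (GaugeField.plaqHol V p); linarith
    -- each large plaquette carries action `≥ δL²/C`
    have hlarge : ∀ p ∈ S, prm.δL ^ 2 / C ≤ 1 - reTr (GaugeField.plaqHol V p) := by
      intro p hp
      rw [div_le_iff₀ hC]
      calc prm.δL ^ 2 ≤ dist1 (GaugeField.plaqHol V p) ^ 2 := pow_le_pow_left₀ hδL (hS p hp) 2
        _ ≤ C * (1 - reTr (GaugeField.plaqHol V p)) := hcmp _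
        _ = (1 - reTr (GaugeField.plaqHol V p)) * C := mul_comm _ _
    have hA : (S.card : ℝ) * (prm.δL ^ 2 / C) ≤ wilsonAction4 V := by
      calc (S.card : ℝ) * (prm.δL ^ 2 / C) = ∑ p ∈ S, prm.δL ^ 2 / C := by rw [Finset.sum_const, nsmul_eq_mul]
        _ ≤ ∑ p ∈ S, (1 - reTr (GaugeField.plaqHol V p)) := Finset.sum_le_sum hlarge
        _ ≤ ∑ p, (1 - reTr (GaugeField.plaqHol V p)) :=
            Finset.sum_le_sum_of_subset_of_nonneg (Finset.subset_univ S) fun p _ _ => hterm p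
        _ = wilsonAction4 V := by simp [wilsonAction4, wilsonAction]
    have hexp : -prm.β * wilsonAction4 V ≤ -(prm.cLF * S.card) := by
      have h2 : prm.cLF * S.card ≤ prm.β * ((S.card : ℝ) * (prm.δL ^ 2 / C)) := by
        have hS0 : (0 : ℝ) ≤ S.card := Nat.cast_nonneg _
        have : prm.cLF ≤ prm.β * (prm.δL ^ 2 / C) := by
          rw [← mul_div_assoc, le_div_iff₀ hC]; exact hLF
        nlinarith
      nlinarith [mul_le_mul_of_nonneg_left hA hβ]
    calc boltzmann P prm.β V = Real.exp (-prm.β * wilsonAction4 V) := rfl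
      _ ≤ Real.exp (-(prm.cLF * S.card)) := Real.exp_le_exp.mpr hexp
      _ ≤ Real.exp (-(prm.cLF * S.card)) * Real.exp (prm.c5 * Fintype.card (Site P 0)) :=
          le_mul_of_one_le_right (Real.exp_pos _).le h1

end LevelZero


/-! ## §2 The same at a level `k = 0` in disguise (`k = j − j` of `MemOfRun` with `K = j`), read through the level identification -/

section Disguise

variable (F : T3Family) {G : Type*} [GaugeGroup G] [MeasurableSpace G] [RegularGaugeGroup G]

/-- Level `k` of the tower `(m, K)` with `k = 0` propositionally (the case `k = K − j`, `K = j` of `BalabanUVClass.MemOfRun`): the Boltzmann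
weight read through `fieldShift` along the (trivial) modulus identification is a class member, by `mem_boltzmann` after `subst`.
[cite: Balaban1985UV3, (1) p.256, (41)-(47) pp.266-267] -/
theorem mem_boltzmann_fieldShift {m K k : ℕ} (hk : k = 0) (e : (F.PP m K).sitesPerDir 0 = (F.PP m K).sitesPerDir k)
    (av : (i : ℕ) → Averaging (F.PP m K) i G) (prm : ClassParams) {C : ℝ} (hC : 0 < C)
    (hcmp : ∀ g : G, dist1 g ^ 2 ≤ C * (1 - reTr g))
    (hδ : prm.δ ≤ prm.δreg) (hβ : 0 ≤ prm.β) (hδL : 0 ≤ prm.δL) (hLF : prm.cLF * C ≤ prm.β * prm.δL ^ 2)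
    (hslack : 0 ≤ prm.slack) (hCcov : 0 ≤ prm.Ccov) (hcE : 0 ≤ prm.cE) (hc5 : 0 ≤ prm.c5) :
    Mem (P := F.PP m K) (k := k) av prm (fun W => boltzmann (F.PP m K) prm.β (fieldShift e W)) := by
  subst hk
  have hfs : (fun W => boltzmann (F.PP m K) prm.β (fieldShift (G := G) e W)) = boltzmann (F.PP m K) prm.β :=
    funext fun W => by rw [fieldShift_refl]
  rw [hfs]
  exact mem_boltzmann av prm hC hcmp hδ hβ hδL hLF hslack hCcov hcE hc5

end Disguise

/-! ## §3 Height `j` of the d = 3 family, gauge group SU(2), averaging of record `ℰp`: `MemAtHeight` of the Boltzmann weight via the run `K = j` -/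

section Height

/-- The group inequality on `SU(2)`: `|g − 1|² ≤ 4(1 − Re tr g)` (tree `cmp'_specialUnitaryGroup` with `2·card(Fin 2) = 4`).
[cite: Balaban1985RegularSpaces, (1.10) p.77] -/
theorem dist1_sq_le_four_mul (g : ↥(Matrix.specialUnitaryGroup (Fin 2) ℂ)) : dist1 g ^ 2 ≤ 4 * (1 - reTr g) := by
  have h := B8Eq110UnitaryProof.cmp'_specialUnitaryGroup (n := Fin 2) g
  norm_num at h
  linarith

variable (F : T3Family)

/-- **`MemAtHeight` OF THE BOLTZMANN WEIGHT OF RUN `j` AT HEIGHT `j`** (SU(2), averaging of record `ℰp`; the witness run is `K = j`, zero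
averaging steps) for every parameter set with coherent signs and `4·cLF ≤ β·δL²`. [cite: Balaban1985UV3, (1) p.256, (41)-(47) pp.266-267, (67)-(71) p.273] -/
theorem memAtHeight_boltzmann (j : ℕ) (prm : ClassParams)
    (hδ : prm.δ ≤ prm.δreg) (hβ : 0 ≤ prm.β) (hδL : 0 ≤ prm.δL) (hLF : prm.cLF * 4 ≤ prm.β * prm.δL ^ 2)
    (hslack : 0 ≤ prm.slack) (hCcov : 0 ≤ prm.Ccov) (hcE : 0 ≤ prm.cE) (hc5 : 0 ≤ prm.c5) :
    MemAtHeight F ℰp j prm (boltzmann (F.P j) prm.β) :=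
  ⟨j, le_rfl, mem_boltzmann_fieldShift F (Nat.sub_self j) (heightShift_eq F le_rfl) _ prm four_pos dist1_sq_le_four_mul
    hδ hβ hδL hLF hslack hCcov hcE hc5⟩

/-- The scheme's inverse coupling at height `j` is the printed background coefficient: `(γε_j)⁻¹ = L^j∕γ`. [cite: Balaban1985UV3, (1)-(3) p.256] -/
theorem scheme_beta_eq (γ : ℝ) (j : ℕ) : (F.scheme ℰp γ).β j = (F.L : ℝ) ^ j / γ := by
  show (γ * (F.P j).eps)⁻¹ = _
  rw [Params.eps]
  show (γ * ((F.L : ℝ)⁻¹) ^ j)⁻¹ = _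
  rw [inv_pow, mul_inv, inv_inv, div_eq_mul_inv, mul_comm]

/-- **THE PRINTED SCHEDULE CARRIES THE BOLTZMANN WEIGHTS OF THE RUNS**: for `0 < γ ≤ 1`, `0 < b₀`, `0 < p₀`, every `0 < κ₀`, `M₀`, `0 ≤ C₀`
and every `R₀ ≥ 2θBal_j` for all `j`, at EVERY height `j` the weight `exp(−(L^j∕γ)·A)` of run `j` is a member with parameters
`printedSchedule F γ b₀ p₀ κ₀ M₀ C₀ R₀ j` (large-field clause: `4·¼p(g_j)² = (L^j∕γ)θ_j² ≤ (L^j∕γ)(2θ_j)²`, `pFun_sq_eq`).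
[cite: Balaban1985UV3, (5) p.256, (7) p.257, (47) p.267, (71) p.273] -/
theorem memAtHeight_boltzmann_printedSchedule {γ b₀ p₀ : ℝ} (hγ : 0 < γ) (hγ1 : γ ≤ 1) (hb₀ : 0 < b₀)
    (κ₀ M₀ : ℝ) {C₀ R₀ : ℝ} (hC₀ : 0 ≤ C₀) (hR₀ : ∀ j, 2 * θBal F.L γ b₀ p₀ j ≤ R₀) (j : ℕ) :
    MemAtHeight F ℰp j (printedSchedule F γ b₀ p₀ κ₀ M₀ C₀ R₀ j) (boltzmann (F.P j) ((F.L : ℝ) ^ j / γ)) := by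
  have hL1 : (1 : ℝ) ≤ F.L := by exact_mod_cast F.hL.2.le
  have hL0 : (0 : ℝ) < F.L := by linarith
  have hθ : 0 < θBal F.L γ b₀ p₀ j := T3MinimiserStabilityReduction.θBal_pos F.hL.2.le hγ hγ1 hb₀ p₀ j
  have hβ : 0 ≤ (F.L : ℝ) ^ j / γ := div_nonneg (pow_nonneg hL0.le j) hγ.le
  have hmem := memAtHeight_boltzmann F j (printedSchedule F γ b₀ p₀ κ₀ M₀ C₀ R₀ j) (hR₀ j) hβ (by
      show (0 : ℝ) ≤ 2 * θBal F.L γ b₀ p₀ j; linarith) (by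
      show B10.pFun b₀ p₀ (Real.sqrt (γ * ((F.L : ℝ)⁻¹) ^ j)) ^ 2 / 4 * 4 ≤ (F.L : ℝ) ^ j / γ * (2 * θBal F.L γ b₀ p₀ j) ^ 2
      rw [AdmissibleClassParams.pFun_sq_eq F hγ b₀ p₀ j]
      nlinarith [sq_nonneg (θBal F.L γ b₀ p₀ j)]) (by
      show (0 : ℝ) ≤ C₀ * ((F.L : ℝ)⁻¹) ^ j; positivity) (by
      show (0 : ℝ) ≤ C₀ * θBal F.L γ b₀ p₀ j ^ 2; positivity) hC₀ hC₀
  exact hmem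

end Height

/-! ## §4 The Wilson law of a run as a density against product Haar, and the named normalisation `κ = log Z` -/

section Gibbs

variable {G : Type*} [GaugeGroup G] [MeasurableSpace G] [RegularGaugeGroup G] [HaarData G]

/-- **THE GIBBS MEASURE IS PRODUCT HAAR WITH THE PROBABILITY DENSITY `boltzmann∕Z`** (`β ≥ 0`). [folklore] -/
theorem gibbsMeasure_eq_withDensity (P : Params) {β : ℝ} (hβ : 0 ≤ β) :
    T4GenFunBounds.gibbsMeasure (G := G) P β =
      (fieldMeasure P 0 G).withDensity (fun U => ENNReal.ofReal (boltzmann P β U / partitionFn (G := G) P β)) := by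
  have hZ : 0 < partitionFn (G := G) P β := partitionFn_pos' P hβ
  rw [T4GenFunBounds.gibbsMeasure, ← withDensity_smul _ (T4GenFunBounds.measurable_ofReal_boltzmann P β)]
  refine withDensity_congr_ae (Eventually.of_forall fun U => ?_)
  show (ENNReal.ofReal (partitionFn (G := G) P β))⁻¹ * ENNReal.ofReal (boltzmann P β U) =
    ENNReal.ofReal (boltzmann P β U / partitionFn (G := G) P β)
  rw [ENNReal.ofReal_div_of_pos hZ, ENNReal.div_eq_inv_mul]

/-- **THE NAMED NORMALISATION**: `exp(log Z) · (boltzmann∕Z) = boltzmann` (`β ≥ 0`, so `Z > 0`). [folklore] -/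
theorem exp_log_partitionFn_mul (P : Params) {β : ℝ} (hβ : 0 ≤ β) (U : GaugeField P 0 G) :
    Real.exp (Real.log (partitionFn (G := G) P β)) * (boltzmann P β U / partitionFn (G := G) P β) = boltzmann P β U := by
  have hZ : 0 < partitionFn (G := G) P β := partitionFn_pos' P hβ
  rw [Real.exp_log hZ, mul_div_cancel₀ _ hZ.ne']

/-- The probability density `boltzmann∕Z` is positive everywhere (`β ≥ 0`). [folklore] -/
theorem boltzmann_div_partitionFn_pos (P : Params) {β : ℝ} (hβ : 0 ≤ β) (U : GaugeField P 0 G) :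
    0 < boltzmann P β U / partitionFn (G := G) P β :=
  div_pos (boltzmann_pos P β U) (partitionFn_pos' P hβ)

end Gibbs

/-- The probability density `boltzmann∕Z` on SU(2) configurations is continuous (the Wilson action is). [folklore] -/
theorem continuous_boltzmann_div (P : Params) (β Z : ℝ) :
    Continuous fun U : GaugeField P 0 ↥(Matrix.specialUnitaryGroup (Fin 2) ℂ) => boltzmann P β U / Z := by
  have h : Continuous (boltzmann (G := ↥(Matrix.specialUnitaryGroup (Fin 2) ℂ)) P β) := by
    unfold boltzmann
    exact (continuous_const.mul (B16Thm1BaseAtRecord11.continuous_wilsonAction4_SU (N := 2) P 0)).rexp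
  exact h.div_const Z

/-! ## §5 `admFR_frame_inhabited`: the ∃κ frame is inhabited at every height by the Wilson law of the run of that height -/

section Frame

variable (F : T3Family)

/-- A uniform bound for the thresholds: `2θBal_j ≤ R₀(γ, b₀, p₀)` for all `j` (`0 < γ ≤ 1`, `0 ≤ b₀`, `0 < p₀`; tree
`T3Thresholds.θBal_le_const_mul_rpow`). [cite: Balaban1985UV3, (7) p.257] -/
theorem two_mul_θBal_le_const {γ b₀ p₀ : ℝ} (hγ : 0 < γ) (hγ1 : γ ≤ 1) (hb₀ : 0 ≤ b₀) (hp₀ : 0 < p₀) (j : ℕ) :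
    2 * θBal F.L γ b₀ p₀ j ≤ 2 * (b₀ * ((2 * p₀) ^ p₀ * Real.exp (1 / 2 - p₀)) * Real.sqrt (Real.sqrt γ)) + 1 := by
  have h := T3Thresholds.θBal_le_const_mul_rpow (L := F.L) F.hL.2.le hγ hγ1 hb₀ hp₀ j
  linarith

/-- **NON-VACUITY OF THE ∃κ-MEMBERSHIP FRAME OF `BackwardStabilityAdmFR` (tribunal J r8 ∕ director-ym R606 (2))**: for every d = 3 torus
family `F`, every `0 < γ ≤ 1`, `0 < b₀`, `0 < p₀` there is an ADMISSIBLE class-parameter schedule `prm` (the printed one) such that AT EVERY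
HEIGHT `j` the frame is inhabited BY THE WILSON RUN `j` ITSELF: `μ_j` = the Gibbs measure of run `j` of the Wilson scheme
(`gibbsK F ℰp γ j = T4GenFunBounds.gibbsMeasure (F.P j) ((F.scheme ℰp γ).β j)`), `ρ_j` = its Haar density `boltzmann∕partitionFn`, and the normalisation
`κ_j = log partitionFn (F.P j) β_j`: `μ_j` is a probability measure, equals `fieldMeasure.withDensity ρ_j`, `ρ_j` is positive and continuous,
and `exp κ_j · ρ_j` is a height-`j` class member with parameters `prm j`. [cite: Balaban1985UV3, (1) p.256, (5) p.256, (41)-(47) pp.266-267, (67)-(71) p.273] -/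
theorem admFR_frame_inhabited (γ : ℝ) (hγ : 0 < γ) (hγ1 : γ ≤ 1) (b₀ p₀ : ℝ) (hb₀ : 0 < b₀) (hp₀ : 0 < p₀) :
    ∃ prm : ℕ → ClassParams, AdmissibleClassParams F γ b₀ p₀ prm ∧ ∀ j : ℕ,
      ∃ (μ : Measure (GaugeField (F.P j) 0 ↥(Matrix.specialUnitaryGroup (Fin 2) ℂ)))
        (ρ : GaugeField (F.P j) 0 ↥(Matrix.specialUnitaryGroup (Fin 2) ℂ) → ℝ) (κ : ℝ),
        μ = gibbsK F ℰp γ j ∧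
        ρ = (fun U => boltzmann (F.P j) ((F.scheme ℰp γ).β j) U /
              partitionFn (G := ↥(Matrix.specialUnitaryGroup (Fin 2) ℂ)) (F.P j) ((F.scheme ℰp γ).β j)) ∧
        κ = Real.log (partitionFn (G := ↥(Matrix.specialUnitaryGroup (Fin 2) ℂ)) (F.P j) ((F.scheme ℰp γ).β j)) ∧
        IsProbabilityMeasure μ ∧
        μ = (fieldMeasure _ _ _).withDensity (fun U => ENNReal.ofReal (ρ U)) ∧
        (∀ U, 0 < ρ U) ∧ Continuous ρ ∧
        MemAtHeight F ℰp j (prm j) (fun U => Real.exp κ * ρ U) := by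
  set R₀ : ℝ := 2 * (b₀ * ((2 * p₀) ^ p₀ * Real.exp (1 / 2 - p₀)) * Real.sqrt (Real.sqrt γ)) + 1 with hR₀
  have hR₀pos : 0 < R₀ := by positivity
  refine ⟨printedSchedule F γ b₀ p₀ 1 0 0 R₀, printedSchedule_admissible F γ b₀ p₀ one_pos 0 0 hR₀pos, fun j => ?_⟩
  have hβj : 0 ≤ (F.scheme ℰp γ).β j := F.scheme_β_nonneg ℰp hγ.le j
  refine ⟨_, _, _, rfl, rfl, rfl, isProbabilityMeasure_gibbsK F ℰp hγ.le j,
    (gibbsK_eq F ℰp γ j).trans (gibbsMeasure_eq_withDensity _ hβj), boltzmann_div_partitionFn_pos _ hβj,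
    continuous_boltzmann_div _ _ _, ?_⟩
  have hfun : (fun U : GaugeField (F.P j) 0 ↥(Matrix.specialUnitaryGroup (Fin 2) ℂ) =>
      Real.exp (Real.log (partitionFn (G := ↥(Matrix.specialUnitaryGroup (Fin 2) ℂ)) (F.P j) ((F.scheme ℰp γ).β j))) *
        (boltzmann (F.P j) ((F.scheme ℰp γ).β j) U /
          partitionFn (G := ↥(Matrix.specialUnitaryGroup (Fin 2) ℂ)) (F.P j) ((F.scheme ℰp γ).β j))) =
      boltzmann (G := ↥(Matrix.specialUnitaryGroup (Fin 2) ℂ)) (F.P j) ((F.L : ℝ) ^ j / γ) := by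
    funext U; rw [exp_log_partitionFn_mul _ hβj, scheme_beta_eq]
  rw [hfun]
  exact memAtHeight_boltzmann_printedSchedule F hγ hγ1 hb₀ 1 0 le_rfl
    (fun i => two_mul_θBal_le_const F hγ hγ1 hb₀.le hp₀ i) j

/-- **THE PER-HEIGHT HYPOTHESIS BLOCK OF `BackwardStabilityAdmFR` (stmt-QuantumFields-28294) IS INHABITED AT EVERY HEIGHT, VERBATIM**, at
`(μ, μ', ρ, ρ') := (μ_j, μ_j, ρ_j, ρ_j)` of `admFR_frame_inhabited` (the Wilson law of run `j` twice), for EVERY rate `ω_j ≥ 0` and EVERY tail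
bound `η_j ≥ 1` (trivially met by a probability measure), with `IsProbabilityMeasure (μ j)`; the four-point clause's left side is `0` for
`ρ = ρ'`.  NOT included: the tower consistency `μ j = (descend F ℰp j)_* μ (j+1)` (Gibbs measures of two heights are not so related; a
consistent tower of members is `ClassLimitTrajectoriesAdmFR`'s content). [cite: Balaban1985UV3, (1) p.256, (41)-(47) pp.266-267] -/
theorem admFR_frame_inhabited_block (γ : ℝ) (hγ : 0 < γ) (hγ1 : γ ≤ 1) (b₀ p₀ κ : ℝ) (hb₀ : 0 < b₀) (hp₀ : 0 < p₀)
    (ω η : ℕ → ℝ) (hω : ∀ j, 0 ≤ ω j) (hη : ∀ j, 1 ≤ η j) :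
    ∃ prm : ℕ → ClassParams, AdmissibleClassParams F γ b₀ p₀ prm ∧
      ∃ (μ μ' : (j : ℕ) → Measure (GaugeField (F.P j) 0 ↥(Matrix.specialUnitaryGroup (Fin 2) ℂ)))
        (ρ ρ' : (j : ℕ) → GaugeField (F.P j) 0 ↥(Matrix.specialUnitaryGroup (Fin 2) ℂ) → ℝ),
        (∀ j, μ j = gibbsK F ℰp γ j ∧ μ' j = μ j ∧ ρ' j = ρ j) ∧
        (∀ j, IsProbabilityMeasure (μ j) ∧ IsProbabilityMeasure (μ' j)) ∧
        ∀ j : ℕ,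
          ((∀ U, PlaqSmall (θBal F.L γ b₀ p₀ j) U → 0 < ρ j U ∧ 0 < ρ' j U) ∧
          μ j = (fieldMeasure _ _ _).withDensity (fun U => ENNReal.ofReal (ρ j U)) ∧
          μ' j = (fieldMeasure _ _ _).withDensity (fun U => ENNReal.ofReal (ρ' j U)) ∧
          (∃ κ : ℝ, MemAtHeight F ℰp j (prm j) (fun U => Real.exp κ * ρ j U)) ∧
          (∃ κ : ℝ, MemAtHeight F ℰp j (prm j) (fun U => Real.exp κ * ρ' j U)) ∧
          (∀ (b b' : PBond (F.P j) 0) U V W Z, PlaqSmall (θBal F.L γ b₀ p₀ j) U → PlaqSmall (θBal F.L γ b₀ p₀ j) V →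
            PlaqSmall (θBal F.L γ b₀ p₀ j) W → PlaqSmall (θBal F.L γ b₀ p₀ j) Z → (∀ e, e ≠ b → U e = V e) →
            (∀ e, e ≠ b' → U e = W e) → (∀ e, e ≠ b' → V e = Z e) → (∀ e, e ≠ b → W e = Z e) →
            |(Real.log (ρ j U) - Real.log (ρ' j U)) - (Real.log (ρ j V) - Real.log (ρ' j V)) -
              ((Real.log (ρ j W) - Real.log (ρ' j W)) - (Real.log (ρ j Z) - Real.log (ρ' j Z)))| ≤
              ω j * Real.exp (-(κ * (b.src.tdist b'.src : ℝ)))) ∧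
          μ j {U | ¬ PlaqSmall (θBal F.L γ b₀ p₀ j) U} ≤ ENNReal.ofReal (η j) ∧
          μ' j {U | ¬ PlaqSmall (θBal F.L γ b₀ p₀ j) U} ≤ ENNReal.ofReal (η j) ∧
          (ContinuousOn (ρ j) {U | PlaqSmall (θBal F.L γ b₀ p₀ j) U} ∧
            ContinuousOn (ρ' j) {U | PlaqSmall (θBal F.L γ b₀ p₀ j) U})) := by
  obtain ⟨prm, hprm, hj⟩ := admFR_frame_inhabited F γ hγ hγ1 b₀ p₀ hb₀ hp₀
  choose μ ρ κj hμ hρ hκ hprob hwd hpos hcont hmem using hj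
  refine ⟨prm, hprm, μ, μ, ρ, ρ, fun j => ⟨hμ j, rfl, rfl⟩, fun j => ⟨hprob j, hprob j⟩, fun j => ?_⟩
  haveI := hprob j
  refine ⟨fun U _ => ⟨hpos j U, hpos j U⟩, hwd j, hwd j, ⟨κj j, hmem j⟩, ⟨κj j, hmem j⟩, ?_, ?_, ?_,
    ⟨(hcont j).continuousOn, (hcont j).continuousOn⟩⟩
  · intro b b' U V W Z _ _ _ _ _ _ _ _
    have h0 : (Real.log (ρ j U) - Real.log (ρ j U)) - (Real.log (ρ j V) - Real.log (ρ j V)) -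
        ((Real.log (ρ j W) - Real.log (ρ j W)) - (Real.log (ρ j Z) - Real.log (ρ j Z))) = 0 := by ring
    rw [h0, abs_zero]
    exact mul_nonneg (hω j) (Real.exp_pos _).le
  · exact prob_le_one.trans (by simpa using ENNReal.ofReal_le_ofReal (hη j))
  · exact prob_le_one.trans (by simpa using ENNReal.ofReal_le_ofReal (hη j))

/-- **THE SAME BLOCK WITH THE TRUE LARGE-FIELD TAILS OF THE RUNS** (`1 ≤ p₀`): the tail clauses are met with the tree's BARE TAIL PROFILE `η`
(`T3BareTailProfile.bareTailAt`: reflection positivity + chessboard + small Haar balls, [Balaban1985UV3] (71) at the finest height) —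
non-negative, SUMMABLE, with summable shifted tails (three of the four standing conditions on `η`; the floor-class `Tendsto` condition needs
the super-polynomial form of the same estimate and is not extracted here).  This is #534 Q1's joint test run by kernel: a probability
density CONCENTRATED on the window (`tails ≤ η_j → 0`) AND in the class — possible exactly because of the scalar `exp κ_j`, `κ_j = log Z_j`.
[cite: Balaban1985UV3, (1) p.256, (7) p.257, (41)-(47) pp.266-267, (71) p.273] -/
theorem admFR_frame_inhabited_block_bareTail (γ : ℝ) (hγ : 0 < γ) (hγ1 : γ ≤ 1) (b₀ p₀ κ : ℝ) (hb₀ : 0 < b₀) (hp₀ : 1 ≤ p₀)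
    (ω : ℕ → ℝ) (hω : ∀ j, 0 ≤ ω j) :
    ∃ prm : ℕ → ClassParams, AdmissibleClassParams F γ b₀ p₀ prm ∧
      ∃ η : ℕ → ℝ, (∀ j, 0 ≤ η j) ∧ Summable η ∧ (Summable fun i => ∑' k, η (k + i)) ∧
      ∃ (μ μ' : (j : ℕ) → Measure (GaugeField (F.P j) 0 ↥(Matrix.specialUnitaryGroup (Fin 2) ℂ)))
        (ρ ρ' : (j : ℕ) → GaugeField (F.P j) 0 ↥(Matrix.specialUnitaryGroup (Fin 2) ℂ) → ℝ),
        (∀ j, μ j = gibbsK F ℰp γ j ∧ μ' j = μ j ∧ ρ' j = ρ j) ∧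
        (∀ j, IsProbabilityMeasure (μ j) ∧ IsProbabilityMeasure (μ' j)) ∧
        ∀ j : ℕ,
          ((∀ U, PlaqSmall (θBal F.L γ b₀ p₀ j) U → 0 < ρ j U ∧ 0 < ρ' j U) ∧
          μ j = (fieldMeasure _ _ _).withDensity (fun U => ENNReal.ofReal (ρ j U)) ∧
          μ' j = (fieldMeasure _ _ _).withDensity (fun U => ENNReal.ofReal (ρ' j U)) ∧
          (∃ κ : ℝ, MemAtHeight F ℰp j (prm j) (fun U => Real.exp κ * ρ j U)) ∧
          (∃ κ : ℝ, MemAtHeight F ℰp j (prm j) (fun U => Real.exp κ * ρ' j U)) ∧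
          (∀ (b b' : PBond (F.P j) 0) U V W Z, PlaqSmall (θBal F.L γ b₀ p₀ j) U → PlaqSmall (θBal F.L γ b₀ p₀ j) V →
            PlaqSmall (θBal F.L γ b₀ p₀ j) W → PlaqSmall (θBal F.L γ b₀ p₀ j) Z → (∀ e, e ≠ b → U e = V e) →
            (∀ e, e ≠ b' → U e = W e) → (∀ e, e ≠ b' → V e = Z e) → (∀ e, e ≠ b → W e = Z e) →
            |(Real.log (ρ j U) - Real.log (ρ' j U)) - (Real.log (ρ j V) - Real.log (ρ' j V)) -
              ((Real.log (ρ j W) - Real.log (ρ' j W)) - (Real.log (ρ j Z) - Real.log (ρ' j Z)))| ≤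
              ω j * Real.exp (-(κ * (b.src.tdist b'.src : ℝ)))) ∧
          μ j {U | ¬ PlaqSmall (θBal F.L γ b₀ p₀ j) U} ≤ ENNReal.ofReal (η j) ∧
          μ' j {U | ¬ PlaqSmall (θBal F.L γ b₀ p₀ j) U} ≤ ENNReal.ofReal (η j) ∧
          (ContinuousOn (ρ j) {U | PlaqSmall (θBal F.L γ b₀ p₀ j) U} ∧
            ContinuousOn (ρ' j) {U | PlaqSmall (θBal F.L γ b₀ p₀ j) U})) := by
  obtain ⟨prm, hprm, hj⟩ := admFR_frame_inhabited F γ hγ hγ1 b₀ p₀ hb₀ (one_pos.trans_le hp₀)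
  obtain ⟨η, hη0, hηs, hηt, hηK⟩ := T3BareTailProfile.bareTailAt F hγ hγ1 hb₀ hp₀
  choose μ ρ κj hμ hρ hκ hprob hwd hpos hcont hmem using hj
  refine ⟨prm, hprm, η, hη0, hηs, hηt, μ, μ, ρ, ρ, fun j => ⟨hμ j, rfl, rfl⟩, fun j => ⟨hprob j, hprob j⟩, fun j => ?_⟩
  haveI := hprob j
  have htail : μ j {U | ¬ PlaqSmall (θBal F.L γ b₀ p₀ j) U} ≤ ENNReal.ofReal (η j) := by
    rw [← ofReal_measureReal (measure_ne_top _ _)]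
    refine ENNReal.ofReal_le_ofReal ?_
    rw [hμ j]
    exact hηK j
  refine ⟨fun U _ => ⟨hpos j U, hpos j U⟩, hwd j, hwd j, ⟨κj j, hmem j⟩, ⟨κj j, hmem j⟩, ?_, htail, htail,
    ⟨(hcont j).continuousOn, (hcont j).continuousOn⟩⟩
  intro b b' U V W Z _ _ _ _ _ _ _ _
  have h0 : (Real.log (ρ j U) - Real.log (ρ j U)) - (Real.log (ρ j V) - Real.log (ρ j V)) -
      ((Real.log (ρ j W) - Real.log (ρ j W)) - (Real.log (ρ j Z) - Real.log (ρ j Z))) = 0 := by ring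
  rw [h0, abs_zero]
  exact mul_nonneg (hω j) (Real.exp_pos _).le

end Frame

end Summit.QuantumFields.YangMills.Theorems.AdmFRFrameInhabited
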